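import Summits.BirchSwinnertonDyer.BirchSwinnertonDyer.Theorems.ThetaPartnerAtTwoSignedMainConjectureCMTwoRankZeroLowerOffTwoAtTwo
import Summits.BirchSwinnertonDyer.BirchSwinnertonDyer.Theorems.ThetaPartnerAtTwoSignedMainConjectureCMTwoRankZeroTorsionOfPoitouTate
import Summits.BirchSwinnertonDyer.BirchSwinnertonDyer.Theorems.ThetaPartnerAtTwoSignedControlAtTwoStubPoitouTateShaRat
import Summits.BirchSwinnertonDyer.BirchSwinnertonDyer.Theorems.ThetaPartnerAtTwoSignedControlAtTwoStubPoitouTateSelmerRat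
import Summits.BirchSwinnertonDyer.BirchSwinnertonDyer.Theorems.ThetaPartnerAtTwoSignedControlAtTwoShaThreeBaseH3Units
import Literature.NumberTheory.GaloisCohomology.PoitouTateTwoRealPlacesSurjectiveHolds
import HarnessLib

/-!
# K2r0 / K2R0P♭ (`SignedMainConjectureCMTwoRankZero[OfPubOfFlat]`, route `ThetaPartnerAtTwo`, line `rankzero`): the composition
# doors with Greenberg's five structure facts AND the three local `+` statements at `2` REMOVED — (EC2)_A is a theorem

Seats of the K2 lineage (`bsd-wall-tp2-p2` g3–g10, width seats) built the line's composition doors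
`signedMainConjectureCMTwoRankZero_at_unitZone_of_local` / `…_at_of_local` (module `…CMTwoRankZeroOfLocal`, p585652),
`…_at_of_local_of_upToTwoPower` (p587266), `…_at_of_honda_of_lowerUpToTwoPower` / `…_of_pub…` / `…_body_of_pub_of_stubs` and the
v16 TURNKEY `SignedLowerOffTwo.signedMainConjectureCMTwoRankZero_body_of_pub_of_offTwoLower_of_flat` (p610476) — the term behind the
registered skeleton `Cruxes/SignedMainConjectureCMTwoRankZeroOfPubOfFlat/Lines/rankzero.lean` (`…OfPubOfFlat_of`).  In every one of
them Greenberg's five printed structure facts {Prop. 4.13 `hC`, Prop. 4.12 `h412`, corank `hcork`, p. 108 `hP108`, weak Leopoldt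
`hWL`} and the three LOCAL `+` statements at `2` (`hlev`, `hcyc`, `hlocK`, later discharged from HONDA⁺@2) enter through ONE term
only: the signed Γ-Euler characteristic package
`hEC : ∀ κ γ, κ.IsCyclotomic → κ.IsTopGenerator γ → Finite Sel_{2^∞}(A/ℚ) → (EC2)_A` = `signedEulerCharTwo_at_of_local …`.

The K4 lineage (crux `SignedControlAtTwo`, CLOSED 2026-08-28 11:42Z) proves (EC2)_A OUTRIGHT for every globally minimal `A/ℚ`
good supersingular at `2` with `a₂ = 0`: seat bsd-inputs-k4-p1's `SignedEC.TorsionPT.signedEulerCharTwo_of_poitouTate_four` (EC2 ⟸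
the four generic Poitou–Tate rows over `ℚ`, via Cassels ⟸ PT(b), `Ш²(ℚ, E[2^∞]) = 0` ⟸ PT(a)+4.10(c)₃+4.16, `res²` injective ⟹
COINV — the K4 `eulerchar` road, whose local inputs LOC⁺@2 are theorems), and since 11:36Z the four rows are tree theorems
(`SignedEC.PoitouTateSelmerRat.stub_poitouTateSelmerRat` p625615, `SignedEC.PoitouTateShaRat.stub_poitouTateShaRat` p629917,
`SignedEC.ShaThreeBrauer.poitouTate_three_realPlaces_injective_holds ℚ` p628282, `poitouTate_two_realPlaces_surjective_holds ℚ`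
p618871).  This file re-runs the K2 composition doors with that `hEC`:

* §1 `signedEulerCharTwo_allPairs` — the package `hEC` for `A`, hypothesis-free;
* §2 `signedMainConjectureCMTwoRankZero_at_unitZone_noGreenberg` — K2r0 AT `A` on the unit zone from PUB⁵ = {Burungale–Flach,
  modularity, entire `L`, GZK, the period fact at `2`} ALONE (p585652 §5 with 8 hypotheses fewer);
* §3 `signedMainConjectureCMTwoRankZero_at_of_lower_noGreenberg` (PUB⁵ + (E)_A + (μ♭)_A), `…_at_of_upToTwoPower_noGreenberg`
  (PUB⁵ + (MC±2^k)_A + (μ♭)_A), `…_at_of_lowerUpToTwoPower_noGreenberg` (PUB⁵ + (LD±2^k)_A + (μ♭)_A);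
* §4 `signedMainConjectureCMTwoRankZero_body_of_stubs_noGreenberg` (class-wide body from PUB⁵ + (LD±2^k) + (μ♭)) and the
  **TURNKEY `SignedLowerOffTwo.signedMainConjectureCMTwoRankZero_body_of_offTwoLower_of_flat_noGreenberg`** (PUB⁵ + (LDℓ) + (μ♭)):
  the v16 turnkey VERBATIM minus the five Greenberg binders, torsion from `SignedEC.TorsionPT.signedTorsionTwoRankZero_of_poitouTate`
  discharged (GZK alone).

USE (lead `bsd-wall-tp2-p2` / pen, their call): in `…OfPubOfFlat_of` replace
`…_body_of_pub_of_offTwoLower_of_flat hBF hmod hLrat hGZK h2 hC h412 hcork hP108 hWL` by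
`…_body_of_offTwoLower_of_flat_noGreenberg hBF hmod hLrat hGZK h2` (the five Greenberg binders become idle `_`); the pen may then
restate the twin with PUB¹⁰ → PUB⁵ and — together with K4 closed and `SignedTransportAtTwo.signedTransportAtTwo_rankZero_of_gzk`
(p632271) for K1P — drop `hPubG : PublishedInputsGreenbergControlAtTwo` (24143) from `closes` altogether.

Seat `prover-bsd-wall-tp2-p3-w3` (K4 width 3/3, gen 10), `--supports stmt-BirchSwinnertonDyer-26471`.  Proof bodies are those of
p585652 / p587266 / p588365-lineage doors with `hEC` swapped — credited there; nothing else is re-derived.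

HONEST FRAMING.  CONDITIONAL results: PUB⁵ are published inputs taken BY NAME; (LDℓ)/(LD±2^k)/(E)_A and (μ♭) are the line's
RESEARCH binders (its registered stubs `stub_poitouTateDeepTwo` / `stub_zetaErlKSideCMTwo` feed (LDℓ)); nothing here proves
them.  No item is closed; K2R0P♭ stays OPEN; the Birch–Swinnerton-Dyer conjecture is NOT proved by any of this.
-/

set_option autoImplicit false
-- the Theorems namespace of this sub repeats the summit name by design (D-0017 nested layout)
set_option linter.dupNamespace false

noncomputable section

open scoped Classical NumberField MatrixGroups ModularForm

open NumberField IsDedekindDomain CongruenceSubgroup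

namespace Summit.BirchSwinnertonDyer.BirchSwinnertonDyer.Theorems

open Literature.NumberTheory.EllipticCurves Literature.NumberTheory.GaloisRepresentations
  Literature.NumberTheory.GaloisCohomology WeierstrassCurve ZpExtension
  Literature.NumberTheory.EllipticCurves.Kobayashi2003 Literature.NumberTheory.EllipticCurves.IwasawaDual
  Literature.NumberTheory.EllipticCurves.IwasawaAlgebra Literature.NumberTheory.EllipticCurves.ModularForms
  Literature.NumberTheory.EllipticCurves.Rank1Residual Literature.NumberTheory.EllipticCurves.Module
  Summit.BirchSwinnertonDyer.Rank1Residual Summit.BirchSwinnertonDyer.Rank1Residual.Supersingular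

variable (A : WeierstrassCurve ℚ) [A.IsElliptic] [A.IsGloballyMinimal]

/-! ## §1 The signed Γ-Euler characteristic package for `A`, hypothesis-free -/

/-- **(EC2)_A at every cyclotomic top-generator pair, hypothesis-free** (`A/ℚ` globally minimal, good supersingular at `2`,
`a₂ = 0`): the package `hEC` consumed by every K2 composition door — `Finite Sel_{2^∞}(A/ℚ) →` `(Sel⁺_∞)^γ` finite and
`#(Sel⁺_∞)^γ = u·2^{v₂∏c_ℓ}·#Sel_{2^∞}·#(Sel⁺_∞)_γ`.  Seat k4-p1's `signedEulerCharTwo_of_poitouTate_four` with the four Poitou–Tate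
rows over `ℚ` discharged by tree theorems.  BSD is not proved by this.
[cite: BDKim2013, Cor. 3.15 (p. 199)] [cite: MilneADT2006, Ch. I, Thm. 4.10, Cor. 4.16] [cite: GreenbergLNM1716, §4 Prop. 4.13] -/
theorem signedEulerCharTwo_allPairs (hss : GoodSS A 2) (ha : A.frobeniusTrace 2 = 0) :
    ∀ (κ : ZpExtension ℚ 2) (γ : Field.absoluteGaloisGroup ℚ), κ.IsCyclotomic → κ.IsTopGenerator γ →
      Finite (A.selmerGroupPInfty 2) →
    Finite (endInvariants (conjSignedSelmerInfty A κ 1 γ - 1)) ∧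
      ∃ u : ℤ_[2]ˣ, (Nat.card (endInvariants (conjSignedSelmerInfty A κ 1 γ - 1)) : ℚ_[2]) =
        ((u : ℤ_[2]) : ℚ_[2]) * ((2 : ℕ) : ℚ_[2]) ^ (padicValNat 2 A.tamagawaProduct) *
          (Nat.card (A.selmerGroupPInfty 2) : ℚ_[2]) *
            (Nat.card (EndCoinvariants (conjSignedSelmerInfty A κ 1 γ - 1)) : ℚ_[2]) :=
  fun κ _ hκ hγ hSel ↦
    SignedEC.TorsionPT.signedEulerCharTwo_of_poitouTate_four SignedEC.PoitouTateSelmerRat.stub_poitouTateSelmerRat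
      SignedEC.PoitouTateShaRat.stub_poitouTateShaRat (SignedEC.ShaThreeBrauer.poitouTate_three_realPlaces_injective_holds ℚ)
      (poitouTate_two_realPlaces_surjective_holds ℚ) A hss ha κ hκ hγ hSel

/-! ## §2 K2r0 AT `A` on the unit zone from PUB⁵ alone -/

/-- **K2r0 AT `A` on the UNIT ZONE `2 ∤ #Ш(A)·∏c_ℓ(A)` from PUB⁵ = {Burungale–Flach, modularity, entire `L`, GZK, the period fact at
`2`} ALONE** — `signedMainConjectureCMTwoRankZero_at_unitZone_of_local` (p585652 §5) with its five Greenberg binders and three local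
`+` statements at `2` removed ((EC2)_A from §1).  Conditional on PUB⁵; BSD is not proved by this.
[cite: BurungaleFlach2024, Thm. 1.1] [cite: Kobayashi2003, Thm. 1.2, Conjecture (p. 2)] [cite: BDKim2013, Cor. 3.15] -/
theorem signedMainConjectureCMTwoRankZero_at_unitZone_noGreenberg
    (hBF : bsdTriple_of_hasCM_of_L_one_ne_zero)
    (hmod : nonempty_modularParametrizationData) (hLrat : hasEntireLFunction_rat)
    (hGZK : rank_eq_analyticRank_of_analyticRank_le_one)
    (h2 : Literature.NumberTheory.EllipticCurves.realPeriodRat_eq_unit_mul_plusPeriod_two)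
    (hcm : A.HasCM) (hr : A.analyticRank = 0) (hss : GoodSS A 2) (ha : A.frobeniusTrace 2 = 0)
    (hunit : ¬ 2 ∣ A.shaOrder * A.tamagawaProduct) :
    (∀ (κ : ZpExtension ℚ 2) (γ : Field.absoluteGaloisGroup ℚ), κ.IsCyclotomic → κ.IsTopGenerator γ →
      ∀ D : SignedSelmerDualData A κ γ 1, Module.IsTorsion (IwasawaAlgebra 2) D.X ∧ D.mu = 0) ∧
    KobayashiMainConjecture A 2 1 := by
  have hL : A.entireLFunction 1 ≠ 0 := (A.analyticRank_eq_zero_iff_holds (hLrat A)).mp hr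
  have hSel : Finite (A.selmerGroupPInfty 2) := finite_selmerGroupPInfty_two_of_analyticRank_eq_zero A hGZK hr
  have hEC := signedEulerCharTwo_allPairs A hss ha
  exact signedMainConjectureCMTwo_pointwise_of_unitZone A hBF hmod hGZK hcm hss ha hL
    (finiteTorsion_at_of_signedEulerCharTwo hEC hSel) (kimControl_at_of_signedEulerCharTwo hEC)
    (unitZone_of_not_two_dvd_shaOrder_mul_tamagawaProduct A hBF hLrat hGZK h2 hcm hr hss hunit)

/-! ## §3 K2r0 AT `A` from PUB⁵ + the Eisenstein half (three currencies) + (μ♭)_A -/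

/-- **K2r0 AT `A` from PUB⁵ + (E)_A `KobayashiLowerDivisibility A 2 1` + (μ♭)_A** — `signedMainConjectureCMTwoRankZero_at_of_local`
(p585652 §6) with the five Greenberg binders and the three local statements removed.  Conditional on PUB⁵ and the two research
binders; BSD is not proved by this.
[cite: PollackRubin2004, Thm. 7.3 (p > 2)] [cite: Kobayashi2003, Thm. 1.2, Conjecture (p. 2)] [cite: BurungaleFlach2024, Thm. 1.1] -/
theorem signedMainConjectureCMTwoRankZero_at_of_lower_noGreenberg
    (hBF : bsdTriple_of_hasCM_of_L_one_ne_zero)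
    (hmod : nonempty_modularParametrizationData) (hLrat : hasEntireLFunction_rat)
    (hGZK : rank_eq_analyticRank_of_analyticRank_le_one)
    (h2 : Literature.NumberTheory.EllipticCurves.realPeriodRat_eq_unit_mul_plusPeriod_two)
    (hcm : A.HasCM) (hr : A.analyticRank = 0) (hss : GoodSS A 2) (ha : A.frobeniusTrace 2 = 0)
    (hlow : KobayashiLowerDivisibility A 2 1)
    (hflat : ∀ [NeZero (A.conductorNorm ℤ)] (f : CuspForm (Gamma0 (A.conductorNorm ℤ)) 2),
      IsNewformOf A f → ∀ (Lplus Lminus : IwasawaAlgebra 2), IsPollackPair f 2 Lplus Lminus →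
        ∃ n : ℕ, IsUnit (PowerSeries.coeff n (kobayashiL 1 Lplus Lminus))) :
    (∀ (κ : ZpExtension ℚ 2) (γ : Field.absoluteGaloisGroup ℚ), κ.IsCyclotomic → κ.IsTopGenerator γ →
      ∀ D : SignedSelmerDualData A κ γ 1, Module.IsTorsion (IwasawaAlgebra 2) D.X ∧ D.mu = 0) ∧
    KobayashiMainConjecture A 2 1 := by
  have hSel : Finite (A.selmerGroupPInfty 2) := finite_selmerGroupPInfty_two_of_analyticRank_eq_zero A hGZK hr
  have hEC := signedEulerCharTwo_allPairs A hss ha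
  have hT2 : ∀ (κ : ZpExtension ℚ 2) (γ : Field.absoluteGaloisGroup ℚ), κ.IsCyclotomic → κ.IsTopGenerator γ →
      ∀ D : SignedSelmerDualData A κ γ 1, Module.IsTorsion (IwasawaAlgebra 2) D.X :=
    fun κ γ hκ hγ D ↦ (finiteTorsion_at_of_signedEulerCharTwo hEC hSel κ γ hκ hγ D).2
  obtain ⟨hMC, hnorm⟩ := signedMainConjectureCMTwo_at_rankZero_of_lowerDivisibility A hBF hmod hLrat hGZK hcm hss
    ha hr hT2 (kimControl_at_of_signedEulerCharTwo hEC) hlow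
    (fun f hf ϖ hϖ Lplus Lminus hPP ↦ ⟨padicValRat_periodRatio_eq_zero_two A h2 hss hf hϖ, hflat f hf Lplus Lminus hPP⟩)
  refine ⟨fun κ γ hκ hγ D ↦ ⟨hT2 κ γ hκ hγ D, ?_⟩, hMC⟩
  exact stub_generatorChangeCMTwo A hcm hr hss ha hT2 (fun κ₀ γ₀ hκ₀ hγ₀ hγ₀' D₀ ↦ (hnorm κ₀ γ₀ hκ₀ hγ₀ hγ₀' D₀).2)
    κ γ hκ hγ D

/-- **K2r0 AT `A` from PUB⁵ + (MC±2^k)_A (the `+` main conjecture for `A` modulo powers of `2`) + (μ♭)_A** —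
`signedMainConjectureCMTwoRankZero_at_of_local_of_upToTwoPower` (p587266) with the five Greenberg binders and the three local
statements removed.  Conditional; BSD is not proved by this.
[cite: PollackRubin2004, Thm. 7.3 (p > 2)] [cite: BurungaleFlach2024, Thm. 1.1 and Remark 7] [cite: Kobayashi2003, Conjecture (p. 2)] -/
theorem signedMainConjectureCMTwoRankZero_at_of_upToTwoPower_noGreenberg
    (hBF : bsdTriple_of_hasCM_of_L_one_ne_zero)
    (hmod : nonempty_modularParametrizationData) (hLrat : hasEntireLFunction_rat)
    (hGZK : rank_eq_analyticRank_of_analyticRank_le_one)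
    (h2 : Literature.NumberTheory.EllipticCurves.realPeriodRat_eq_unit_mul_plusPeriod_two)
    (hcm : A.HasCM) (hr : A.analyticRank = 0) (hss : GoodSS A 2) (ha : A.frobeniusTrace 2 = 0)
    (hup : ∀ (κ : ZpExtension ℚ 2) (γ : Field.absoluteGaloisGroup ℚ),
      κ.IsCyclotomic → κ.IsTopGenerator γ → IsCyclotomicVariable 2 γ →
      ∀ [NeZero (A.conductorNorm ℤ)] (f : CuspForm (Gamma0 (A.conductorNorm ℤ)) 2),
        IsNewformOf A f → ∀ (ϖ : ℚ), (ϖ : ℝ) * A.realPeriodRat = plusPeriod f →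
      ∀ (Lplus Lminus : IwasawaAlgebra 2), IsPollackPair f 2 Lplus Lminus →
      ∀ (D : SignedSelmerDualData A κ γ 1),
        ∃ (g : IwasawaAlgebra 2) (m m' : ℕ), D.charIdeal = Ideal.span {g} ∧
          PowerSeries.C ((2 : ℚ_[2]) ^ m') * iwasawaToPowerSeries 2 g =
            PowerSeries.C ((2 : ℚ_[2]) ^ m * (ϖ : ℚ_[2])) * iwasawaToPowerSeries 2 (kobayashiL 1 Lplus Lminus))
    (hflat : ∀ [NeZero (A.conductorNorm ℤ)] (f : CuspForm (Gamma0 (A.conductorNorm ℤ)) 2),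
      IsNewformOf A f → ∀ (Lplus Lminus : IwasawaAlgebra 2), IsPollackPair f 2 Lplus Lminus →
        ∃ n : ℕ, IsUnit (PowerSeries.coeff n (kobayashiL 1 Lplus Lminus))) :
    (∀ (κ : ZpExtension ℚ 2) (γ : Field.absoluteGaloisGroup ℚ), κ.IsCyclotomic → κ.IsTopGenerator γ →
      ∀ D : SignedSelmerDualData A κ γ 1, Module.IsTorsion (IwasawaAlgebra 2) D.X ∧ D.mu = 0) ∧
    KobayashiMainConjecture A 2 1 := by
  have hSel : Finite (A.selmerGroupPInfty 2) := finite_selmerGroupPInfty_two_of_analyticRank_eq_zero A hGZK hr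
  have hEC := signedEulerCharTwo_allPairs A hss ha
  have hT2 : ∀ (κ : ZpExtension ℚ 2) (γ : Field.absoluteGaloisGroup ℚ), κ.IsCyclotomic → κ.IsTopGenerator γ →
      ∀ D : SignedSelmerDualData A κ γ 1, Module.IsTorsion (IwasawaAlgebra 2) D.X :=
    fun κ γ hκ hγ D ↦ (finiteTorsion_at_of_signedEulerCharTwo hEC hSel κ γ hκ hγ D).2
  exact signedMainConjectureCMTwoRankZero_at_of_lower_noGreenberg A hBF hmod hLrat hGZK h2 hcm hr hss ha
    (kobayashiLowerDivisibility_of_upToTwoPower A hBF hLrat hGZK hcm hr hss ha hT2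
      (kimControl_at_of_signedEulerCharTwo hEC) hup)
    hflat

/-- **K2r0 AT `A` from PUB⁵ + the ONE-SIDED (LD±2^k)_A + (μ♭)_A** — `signedMainConjectureCMTwoRankZero_at_of_honda_of_lowerUpToTwoPower`
with the five Greenberg binders and the Honda₂ input removed ((E)_A from `kobayashiLowerDivisibility_two_one_of_lowerUpToTwoPower_of_flat`).
Conditional; BSD is not proved by this.
[cite: PollackRubin2004, Thm. 7.3 (p > 2)] [cite: Kobayashi2003, Conjecture (p. 2)] [cite: AbbesUllmo1996, Thm. A] -/
theorem signedMainConjectureCMTwoRankZero_at_of_lowerUpToTwoPower_noGreenberg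
    (hBF : bsdTriple_of_hasCM_of_L_one_ne_zero)
    (hmod : nonempty_modularParametrizationData) (hLrat : hasEntireLFunction_rat)
    (hGZK : rank_eq_analyticRank_of_analyticRank_le_one)
    (h2 : Literature.NumberTheory.EllipticCurves.realPeriodRat_eq_unit_mul_plusPeriod_two)
    (hcm : A.HasCM) (hr : A.analyticRank = 0) (hss : GoodSS A 2) (ha : A.frobeniusTrace 2 = 0)
    (hlow : ∀ (κ : ZpExtension ℚ 2) (γ : Field.absoluteGaloisGroup ℚ),
      κ.IsCyclotomic → κ.IsTopGenerator γ → IsCyclotomicVariable 2 γ →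
      ∀ [NeZero (A.conductorNorm ℤ)] (f : CuspForm (Gamma0 (A.conductorNorm ℤ)) 2),
        IsNewformOf A f → ∀ (ϖ : ℚ), (ϖ : ℝ) * A.realPeriodRat = plusPeriod f →
      ∀ (Lplus Lminus : IwasawaAlgebra 2), IsPollackPair f 2 Lplus Lminus →
      ∀ (D : SignedSelmerDualData A κ γ 1),
        ∃ (g h : IwasawaAlgebra 2) (m m' : ℕ), D.charIdeal = Ideal.span {g} ∧
          PowerSeries.C ((2 : ℚ_[2]) ^ m') * iwasawaToPowerSeries 2 g =
            PowerSeries.C ((2 : ℚ_[2]) ^ m * (ϖ : ℚ_[2])) * iwasawaToPowerSeries 2 (kobayashiL 1 Lplus Lminus * h))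
    (hflat : ∀ [NeZero (A.conductorNorm ℤ)] (f : CuspForm (Gamma0 (A.conductorNorm ℤ)) 2),
      IsNewformOf A f → ∀ (Lplus Lminus : IwasawaAlgebra 2), IsPollackPair f 2 Lplus Lminus →
        ∃ n : ℕ, IsUnit (PowerSeries.coeff n (kobayashiL 1 Lplus Lminus))) :
    (∀ (κ : ZpExtension ℚ 2) (γ : Field.absoluteGaloisGroup ℚ), κ.IsCyclotomic → κ.IsTopGenerator γ →
      ∀ D : SignedSelmerDualData A κ γ 1, Module.IsTorsion (IwasawaAlgebra 2) D.X ∧ D.mu = 0) ∧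
    KobayashiMainConjecture A 2 1 :=
  signedMainConjectureCMTwoRankZero_at_of_lower_noGreenberg A hBF hmod hLrat hGZK h2 hcm hr hss ha
    (kobayashiLowerDivisibility_two_one_of_lowerUpToTwoPower_of_flat A h2 hss hlow hflat) hflat

/-! ## §4 Class-wide: the crux BODY from PUB⁵ + the research binders, and the Greenberg-free TURNKEY -/

/-- **The BODY of K2r0, class-wide, from PUB⁵ + (LD±2^k) + (μ♭)** — `signedMainConjectureCMTwoRankZero_body_of_pub_of_stubs` with the
five Greenberg binders removed (cases on the zone: §3 off-zone, §2 on the unit zone).  Conditional; BSD is not proved by this.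
[cite: PollackRubin2004, Thm. 7.3 (p > 2)] [cite: Kobayashi2003, Thm. 1.2, §8.4, Conjecture (p. 2)] [cite: BurungaleFlach2024, Thm. 1.1] -/
theorem signedMainConjectureCMTwoRankZero_body_of_stubs_noGreenberg
    (hBF : bsdTriple_of_hasCM_of_L_one_ne_zero)
    (hmod : nonempty_modularParametrizationData) (hLrat : hasEntireLFunction_rat)
    (hGZK : rank_eq_analyticRank_of_analyticRank_le_one)
    (h2 : Literature.NumberTheory.EllipticCurves.realPeriodRat_eq_unit_mul_plusPeriod_two)
    (hLD : ∀ (A : WeierstrassCurve ℚ) [A.IsElliptic] [A.IsGloballyMinimal],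
      A.HasCM → A.analyticRank = 0 → GoodSS A 2 → A.frobeniusTrace 2 = 0 →
      2 ∣ A.shaOrder * A.tamagawaProduct →
      ∀ (κ : ZpExtension ℚ 2) (γ : Field.absoluteGaloisGroup ℚ),
        κ.IsCyclotomic → κ.IsTopGenerator γ → IsCyclotomicVariable 2 γ →
      ∀ [NeZero (A.conductorNorm ℤ)] (f : CuspForm (Gamma0 (A.conductorNorm ℤ)) 2),
        IsNewformOf A f → ∀ (ϖ : ℚ), (ϖ : ℝ) * A.realPeriodRat = plusPeriod f →
      ∀ (Lplus Lminus : IwasawaAlgebra 2), IsPollackPair f 2 Lplus Lminus →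
      ∀ (D : SignedSelmerDualData A κ γ 1),
        ∃ (g h : IwasawaAlgebra 2) (m m' : ℕ), D.charIdeal = Ideal.span {g} ∧
          PowerSeries.C ((2 : ℚ_[2]) ^ m') * iwasawaToPowerSeries 2 g =
            PowerSeries.C ((2 : ℚ_[2]) ^ m * (ϖ : ℚ_[2])) * iwasawaToPowerSeries 2 (kobayashiL 1 Lplus Lminus * h))
    (hμ : ∀ (A : WeierstrassCurve ℚ) [A.IsElliptic] [A.IsGloballyMinimal],
      A.HasCM → A.analyticRank = 0 → GoodSS A 2 → A.frobeniusTrace 2 = 0 →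
      2 ∣ A.shaOrder * A.tamagawaProduct →
      ∀ [NeZero (A.conductorNorm ℤ)] (f : CuspForm (Gamma0 (A.conductorNorm ℤ)) 2),
      IsNewformOf A f → ∀ (Lplus Lminus : IwasawaAlgebra 2), IsPollackPair f 2 Lplus Lminus →
        ∃ n : ℕ, IsUnit (PowerSeries.coeff n (kobayashiL 1 Lplus Lminus)))
    (A : WeierstrassCurve ℚ) [A.IsElliptic] [A.IsGloballyMinimal]
    (hcm : A.HasCM) (hr : A.analyticRank = 0) (hss : GoodSS A 2) (ha : A.frobeniusTrace 2 = 0) :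
    (∀ (κ : ZpExtension ℚ 2) (γ : Field.absoluteGaloisGroup ℚ), κ.IsCyclotomic → κ.IsTopGenerator γ →
      ∀ D : SignedSelmerDualData A κ γ 1, Module.IsTorsion (IwasawaAlgebra 2) D.X ∧ D.mu = 0) ∧
    KobayashiMainConjecture A 2 1 := by
  by_cases hz : 2 ∣ A.shaOrder * A.tamagawaProduct
  · exact signedMainConjectureCMTwoRankZero_at_of_lowerUpToTwoPower_noGreenberg A hBF hmod hLrat hGZK h2 hcm hr hss ha
      (hLD A hcm hr hss ha hz) (hμ A hcm hr hss ha hz)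
  · exact signedMainConjectureCMTwoRankZero_at_unitZone_noGreenberg A hBF hmod hLrat hGZK h2 hcm hr hss ha hz

namespace SignedLowerOffTwo

/-- **TURNKEY (Greenberg-free): the crux BODY, class-wide, from PUB⁵ + (LDℓ) + (μ♭)** — the v16 turnkey
`signedMainConjectureCMTwoRankZero_body_of_pub_of_offTwoLower_of_flat` (p610476) VERBATIM minus its five Greenberg binders: torsion at
analytic rank `0` from `SignedEC.TorsionPT.signedTorsionTwoRankZero_of_poitouTate` with the four Poitou–Tate rows discharged (GZK alone),
(LDℓ) → (LD±2^k) by `signedLowerDivisibilityUpToTwoPower_of_torsion_of_offTwoLower`, then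
`signedMainConjectureCMTwoRankZero_body_of_stubs_noGreenberg`.  In the registered skeleton `…OfPubOfFlat_of` this term replaces the
v16 turnkey with `hC h412 hcork hP108 hWL` idle.  Conditional on PUB⁵ + the research binders; BSD is not proved by this.
[cite: PollackRubin2004, Thm. 7.3 (p > 2)] [cite: Kobayashi2003, Thm. 1.2, Conjecture (p. 2)] [cite: BurungaleFlach2024, Thm. 1.1] -/
theorem signedMainConjectureCMTwoRankZero_body_of_offTwoLower_of_flat_noGreenberg
    (hBF : bsdTriple_of_hasCM_of_L_one_ne_zero)
    (hmod : nonempty_modularParametrizationData) (hLrat : hasEntireLFunction_rat)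
    (hGZK : rank_eq_analyticRank_of_analyticRank_le_one)
    (h2 : Literature.NumberTheory.EllipticCurves.realPeriodRat_eq_unit_mul_plusPeriod_two)
    (hLD : ∀ (A : WeierstrassCurve ℚ) [A.IsElliptic] [A.IsGloballyMinimal],
      A.HasCM → A.analyticRank = 0 → GoodSS A 2 → A.frobeniusTrace 2 = 0 →
      2 ∣ A.shaOrder * A.tamagawaProduct →
      ∀ (κ : ZpExtension ℚ 2) (γ : Field.absoluteGaloisGroup ℚ),
        κ.IsCyclotomic → κ.IsTopGenerator γ → IsCyclotomicVariable 2 γ →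
      ∀ [NeZero (A.conductorNorm ℤ)] (f : CuspForm (Gamma0 (A.conductorNorm ℤ)) 2),
        IsNewformOf A f → ∀ (ϖ : ℚ), (ϖ : ℝ) * A.realPeriodRat = plusPeriod f →
      ∀ (Lplus Lminus : IwasawaAlgebra 2), IsPollackPair f 2 Lplus Lminus →
      ∀ (D : SignedSelmerDualData A κ γ 1), Module.IsTorsion (IwasawaAlgebra 2) D.X →
        ∀ 𝔭 : PrimeSpectrum (IwasawaAlgebra 2), 𝔭.asIdeal.height = 1 →
          PowerSeries.C (2 : ℤ_[2]) ∉ 𝔭.asIdeal →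
          lengthAt (IwasawaAlgebra 2) (IwasawaAlgebra 2 ⧸ Ideal.span {kobayashiL 1 Lplus Lminus}) 𝔭 ≤
            lengthAt (IwasawaAlgebra 2) D.X 𝔭)
    (hμ : ∀ (A : WeierstrassCurve ℚ) [A.IsElliptic] [A.IsGloballyMinimal],
      A.HasCM → A.analyticRank = 0 → GoodSS A 2 → A.frobeniusTrace 2 = 0 →
      2 ∣ A.shaOrder * A.tamagawaProduct →
      ∀ [NeZero (A.conductorNorm ℤ)] (f : CuspForm (Gamma0 (A.conductorNorm ℤ)) 2),
      IsNewformOf A f → ∀ (Lplus Lminus : IwasawaAlgebra 2), IsPollackPair f 2 Lplus Lminus →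
        ∃ n : ℕ, IsUnit (PowerSeries.coeff n (kobayashiL 1 Lplus Lminus)))
    (A : WeierstrassCurve ℚ) [A.IsElliptic] [A.IsGloballyMinimal]
    (hcm : A.HasCM) (hr : A.analyticRank = 0) (hss : GoodSS A 2) (ha : A.frobeniusTrace 2 = 0) :
    (∀ (κ : ZpExtension ℚ 2) (γ : Field.absoluteGaloisGroup ℚ), κ.IsCyclotomic → κ.IsTopGenerator γ →
      ∀ D : SignedSelmerDualData A κ γ 1, Module.IsTorsion (IwasawaAlgebra 2) D.X ∧ D.mu = 0) ∧
    KobayashiMainConjecture A 2 1 :=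
  signedMainConjectureCMTwoRankZero_body_of_stubs_noGreenberg hBF hmod hLrat hGZK h2
    (signedLowerDivisibilityUpToTwoPower_of_torsion_of_offTwoLower
      (SignedEC.TorsionPT.signedTorsionTwoRankZero_of_poitouTate hGZK SignedEC.PoitouTateSelmerRat.stub_poitouTateSelmerRat
        SignedEC.PoitouTateShaRat.stub_poitouTateShaRat (SignedEC.ShaThreeBrauer.poitouTate_three_realPlaces_injective_holds ℚ)
        (poitouTate_two_realPlaces_surjective_holds ℚ))
      hLD)
    hμ A hcm hr hss ha

end SignedLowerOffTwo

end Summit.BirchSwinnertonDyer.BirchSwinnertonDyer.Theorems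

end
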